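import Summits.QuantumFields.BalabanUV.Beta.FP.MixLoopPowerCounting

/-!
# `BalabanUV.Beta.FP.MixLoopPowerCountingGamma` — road «FP» (binder row D1), remainder `ρ_n` of the H′ bookkeeping, row **RHOA-6c** «GENERIC POWER
# COUNTING OF THE MIX LOOPS», FILE B of three: the loop **(MIX-1)** `tr(G_C·Q̇Γ₀Q̇ᵀ)` FROM ITS LETTERS, summed VERTEX-FIRST
# ([folklore] lattice bookkeeping on `ℤ⁴`; abstract kernels, every letter a displayed hypothesis; NO road object)

HONEST DEPENDENCY (page 1, mandatory): continuum YM on T⁴ ⇐ BetaPertH ∧ nine spine estimates (0/9 proved); BetaPertH ⇐ (D1) ∧ (D4) ∧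
CAP+tail; G-an2-4 gates asym, D1 and NE2/3/4.  HONEST FRAMING (cell contract, verbatim): «discharging `BetaPertH` makes Bałaban's UV
stability UNCONDITIONAL — a real constructive-QFT result; it is NOT the continuum limit and NOT the Clay problem.»  THIS MODULE is elementary
[folklore] real analysis on `ℤ⁴` over FILE A's shell engine (`MixLoopPowerCounting.sum_le_engine_of_le`, `sum_exp_le`); it asserts nothing about Bałaban's
objects, cites nothing, mints no `Prop` fact, has no `def`, 0 sorry.  The LETTERS of `q̇` (row RHOA-6b), `G_C` (row IR-2) and `Γ₀` (rows IR-1∕IR-Q near, IR-5 far)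
are HYPOTHESES displayed in the signatures; NOT `Mix_n = O(1)` for Bałaban's objects (row RHOA-6e assembles), NOT `hbook`, NOT D1, NOT BetaPertH, NOT continuum,
NOT Clay.

ROW (owner b2b-balaban-beta-d1-p3-g6, `RHOA-DESIGN.md` v1.1 §2bis): (MIX-1) `tr(G_CQ̇PQ̇ᵀ) − tr(G_CQ̇AG_CAᵀQ̇ᵀ) = tr(G_C·Q̇Γ₀Q̇ᵀ)` «two averaging 3-jets joined
by the CONSTRAINED covariance and by `G_C`»; letters «(q̇) for a collinear pair `b − b′ = t·e_μ`, `0 < t < n`: `Σ_u |q̇(u;b′,b)| ≤ n⁻⁵·(n−t) ≤ n⁻⁴`; given `b′`,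
fewer than `n` partners», «(Γ₀) near `|z| ≤ n`: `|Γ₀| ≤ C(|z|+1)⁻²` …; far: `× e^{−δ|z|/n}`», «(G_C) `|G_C(u,u′)| ≤ Cn²e^{−δr}`»; power counting «(MIX-1)
`k ~ n²e^{−δr}·(n⁻³)²·|Γ₀(z)| ~ n⁻⁴(|z|+1)⁻²e^{−δ|z|/n}`: `n⁻⁴Σ_z(|z|+1)⁻²|z|² ~ n⁻⁴·n⁴ = O(1)`».

WHY VERTEX-FIRST (located INFO I-ne7bleaf01g23-1, journal l.23908; model level, inside the abstract letters).  The pointwise shape `n⁻⁴(|z|+1)⁻²` does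
NOT follow from the letters at near-collinear separations: for `‖z‖ < 4n` with `z` within `O(1)` of a coordinate axis, smearing `Γ₀` over the two field-leg
segments of length `n` gives `Σ_{w,w′}(|z+w′−w|+1)⁻² ≍ n`, i.e. `|k₁| ≍ n⁻⁵` there (and `≍ n⁻⁶·log` near coordinate 2-planes); those separations have small
measure, so the SECOND MOMENT is still O(1) with the exact power.  The proof below therefore never states a pointwise shape: it bounds `|k₁(b,b′)|` by the
vertex sum `C_G·(A∕n⁴)²·n²·Σ_{w,w′}|Γ₀(b+w,b′+w′)|` (`abs_mix1_le_vertexSum`), swaps `Σ_{b′}` inside `Σ_{w,w′}` (the field-leg offsets `W` are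
translation-invariant, so the dual count is `#W ≤ N₀·n`), and spends `‖b′−b‖² ≤ 2‖y‖² + 8n²` (`y = (b+w) − (b′+w′)`) against the engine: `Σ_y 2e^{−(δ∕n)|y|} +
8n²·e^{−(δ∕n)|y|}∕(|y|+1)² ≤ (2·𝔐₃ + 8·𝔐₁)·n⁴`; total `C_G A² n⁻⁶ · (N₀n)² · C_Γ(…)n⁴` — `n⁰`.  ONLY the sup letter `|G_C| ≤ C_G·n²` is used: its coarse exponential
is idle once `Γ₀` carries `e^{−δ|z|∕n}` (with a pure power letter for `Γ₀` one would use `G_C`'s decay instead).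

CONTENT.
* §1 engine instance `sum_inv_sq_mul_exp_le` (`j = 1`: `Σ e^{−(δ∕n)‖z‖}∕(‖z‖+1)² ≤ (1 + 80e^{δ∕2}(2∕δ)²)·n²`), and the SMEARED-PROFILE second moment
  `sum_sq_shift_profile_le` (`Σ_{b′∈S}‖b′−b‖²·(‖y‖+1)⁻²e^{−(δ∕n)‖y‖}`, `y = c − b′ − w′`, `‖c−b‖, ‖w′‖ ≤ n` ⟹ `≤ 𝔎(δ)·n⁴`).
* §2 (MIX-1): `sum_comm₄`, `abs_mix1_le_vertexSum`, **`mix1_secondMoment_le`** (`Σ_{b′∈S}‖b′−b‖²|k₁(b,b′)| ≤ C_G·A²·N₀²·C_Γ·𝔎(δ)`, `𝔎(δ) = 2(1+480e^{δ∕2}(2∕δ)⁴) +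
  8(1+80e^{δ∕2}(2∕δ)²)`, n-FREE).
* §3 `tsum` forms over all `b′ ∈ ℤ⁴` (`summable_of_sum_le` ∕ `Real.tsum_le_of_sum_le`): `tsum_mix1_secondMoment_le`, and `tsum_mix2_secondMoment_le` for FILE A's (MIX-2).
Provenance: cross-cell idle-seat kernel duty NE7b → β∕D1, unit `b2b-balaban-t4-ne7b-formalise-leaf-01` gen 23, 2026-08-21; journal INTENT ∕ CLAIM «RHOA-6c» l.23908;
«not in print; our bookkeeping»; no existing file touched.
-/

noncomputable section

namespace Summit.QuantumFields.BalabanUV.Beta.FP.MixLoopPowerCountingGamma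

open Finset Real
open scoped BigOperators
open Literature.MathematicalPhysics.QuantumFieldTheory.Balaban1983to89.Beta.DyadicShell (Pt supNorm)
open Literature.MathematicalPhysics.QuantumFieldTheory.Balaban1983to89.Beta.GradedBubbles (supNorm_neg)
open Literature.MathematicalPhysics.QuantumFieldTheory.Balaban1983to89.Beta.BlockLegs (supNorm_sub_le_real supNorm_add_le_real)
open Summit.QuantumFields.BalabanUV.Beta.FP.MixLoopPowerCounting (sum_le_engine_of_le supNorm_cast_nonneg sum_exp_le mix2_secondMoment_le)

/-! ## §1 The engine instance `j = 1` and the smeared-profile second moment -/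

/-- [folklore] **INVERSE SQUARE × EXPONENTIAL, EXACT POWER n²**: `Σ_{z∈S} e^{−(δ∕n)‖z‖∞}∕(‖z‖∞+1)² ≤ (1 + 80·e^{δ∕2}·(2∕δ)²)·n²`. -/
theorem sum_inv_sq_mul_exp_le {δ : ℝ} (hδ : 0 < δ) {n : ℕ} (hn : 1 ≤ n) (S : Finset Pt) :
    ∑ z ∈ S, Real.exp (-(δ / n) * (supNorm z : ℝ)) / ((supNorm z : ℝ) + 1) ^ 2
      ≤ (1 + 80 * Real.exp (δ / 2) * (2 / δ) ^ 2) * (n : ℝ) ^ 2 := by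
  have h := sum_le_engine_of_le 1 hδ hn (w := fun z => Real.exp (-(δ / n) * (supNorm z : ℝ)) / ((supNorm z : ℝ) + 1) ^ 2)
    (fun z => ?_) S
  · refine h.trans (le_of_eq ?_); norm_num [Nat.factorial]
  · have h1 : (0 : ℝ) < (supNorm z : ℝ) + 1 := by linarith [supNorm_cast_nonneg z]
    rw [pow_one, div_mul_eq_mul_div, div_le_div_iff₀ (pow_pos h1 2) (pow_pos h1 3)]
    nlinarith [Real.exp_pos (-(δ / n) * (supNorm z : ℝ)), pow_pos h1 2]

/-- [folklore] **THE SMEARED-PROFILE SECOND MOMENT**: for a field point `c` within `n` of the insertion `b` and a field-leg offset `w′` within `n`,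
`Σ_{b′∈S} ‖b′−b‖∞²·e^{−(δ∕n)‖c−(b′+w′)‖∞}∕(‖c−(b′+w′)‖∞+1)² ≤ (2(1 + 480e^{δ∕2}(2∕δ)⁴) + 8(1 + 80e^{δ∕2}(2∕δ)²))·n⁴` — EXACT power `n⁴`:
`‖b′−b‖² ≤ 2‖y‖² + 8n²` (`y := c − b′ − w′`), `‖y‖²∕(‖y‖+1)² ≤ 1`, then the engine at `j = 3` and `j = 1`. -/
theorem sum_sq_shift_profile_le {δ : ℝ} (hδ : 0 < δ) {n : ℕ} (hn : 1 ≤ n) {b c w' : Pt}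
    (hc : supNorm (c - b) ≤ n) (hw' : supNorm w' ≤ n) (S : Finset Pt) :
    ∑ b' ∈ S, (supNorm (b' - b) : ℝ) ^ 2 *
        (Real.exp (-(δ / n) * (supNorm (c - (b' + w')) : ℝ)) / ((supNorm (c - (b' + w')) : ℝ) + 1) ^ 2)
      ≤ (2 * (1 + 480 * Real.exp (δ / 2) * (2 / δ) ^ 4) + 8 * (1 + 80 * Real.exp (δ / 2) * (2 / δ) ^ 2)) * (n : ℝ) ^ 4 := by
  have hn' : (0 : ℝ) < n := by exact_mod_cast hn
  set g : Pt → ℝ := fun y => 2 * Real.exp (-(δ / n) * (supNorm y : ℝ))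
      + 8 * (n : ℝ) ^ 2 * (Real.exp (-(δ / n) * (supNorm y : ℝ)) / ((supNorm y : ℝ) + 1) ^ 2) with hg
  -- termwise: `‖b′−b‖²·profile(y) ≤ g y`
  have hterm : ∀ b' ∈ S, (supNorm (b' - b) : ℝ) ^ 2 *
      (Real.exp (-(δ / n) * (supNorm (c - (b' + w')) : ℝ)) / ((supNorm (c - (b' + w')) : ℝ) + 1) ^ 2) ≤ g (c - (b' + w')) := by
    intro b' _
    set y : Pt := c - (b' + w') with hy
    have hys := supNorm_cast_nonneg y
    have h1 : (0 : ℝ) < (supNorm y : ℝ) + 1 := by linarith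
    -- `‖b′ − b‖ ≤ ‖y‖ + 2n`
    have htri : (supNorm (b' - b) : ℝ) ≤ (supNorm y : ℝ) + 2 * n := by
      have e : b' - b = (c - b) - w' - y := by rw [hy]; abel
      have h2 := supNorm_sub_le_real ((c - b) - w') y
      have h3 := supNorm_sub_le_real (c - b) w'
      have h4 : (supNorm (c - b) : ℝ) ≤ n := by exact_mod_cast hc
      have h5 : (supNorm w' : ℝ) ≤ n := by exact_mod_cast hw'
      rw [e]; linarith
    have hsq : (supNorm (b' - b) : ℝ) ^ 2 ≤ 2 * (supNorm y : ℝ) ^ 2 + 8 * (n : ℝ) ^ 2 := by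
      have h0 : (0 : ℝ) ≤ (supNorm (b' - b) : ℝ) := supNorm_cast_nonneg _
      have h2 : (supNorm (b' - b) : ℝ) ^ 2 ≤ ((supNorm y : ℝ) + 2 * n) ^ 2 := pow_le_pow_left₀ h0 htri 2
      nlinarith [h2, sq_nonneg ((supNorm y : ℝ) - 2 * n)]
    set E : ℝ := Real.exp (-(δ / n) * (supNorm y : ℝ)) with hE
    have hE0 : 0 < E := Real.exp_pos _
    have hprof : (supNorm y : ℝ) ^ 2 * (E / ((supNorm y : ℝ) + 1) ^ 2) ≤ E := by
      rw [← mul_div_assoc, div_le_iff₀ (pow_pos h1 2)]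
      have : (supNorm y : ℝ) ^ 2 ≤ ((supNorm y : ℝ) + 1) ^ 2 := by gcongr; linarith
      nlinarith
    calc (supNorm (b' - b) : ℝ) ^ 2 * (E / ((supNorm y : ℝ) + 1) ^ 2)
        ≤ (2 * (supNorm y : ℝ) ^ 2 + 8 * (n : ℝ) ^ 2) * (E / ((supNorm y : ℝ) + 1) ^ 2) :=
          mul_le_mul_of_nonneg_right hsq (by positivity)
      _ = 2 * ((supNorm y : ℝ) ^ 2 * (E / ((supNorm y : ℝ) + 1) ^ 2)) + 8 * (n : ℝ) ^ 2 * (E / ((supNorm y : ℝ) + 1) ^ 2) := by ring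
      _ ≤ 2 * E + 8 * (n : ℝ) ^ 2 * (E / ((supNorm y : ℝ) + 1) ^ 2) := by gcongr
      _ = g y := by rw [hg]
  -- reindex `b′ ↦ y = c − (b′ + w′)` (injective) and apply the engine twice
  have hinj : Set.InjOn (fun b' : Pt => c - (b' + w')) S := by
    intro x _ x' _ h
    have : c - (x + w') = c - (x' + w') := h
    have h2 := sub_right_injective this
    exact add_left_injective w' h2
  have hsum : ∑ b' ∈ S, g (c - (b' + w')) = ∑ y ∈ S.image (fun b' => c - (b' + w')), g y := (Finset.sum_image hinj).symm
  set S' := S.image (fun b' => c - (b' + w')) with hS'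
  have hA := sum_exp_le hδ hn S'
  have hB := sum_inv_sq_mul_exp_le hδ hn S'
  calc _ ≤ ∑ b' ∈ S, g (c - (b' + w')) := Finset.sum_le_sum hterm
    _ = ∑ y ∈ S', g y := hsum
    _ = 2 * ∑ y ∈ S', Real.exp (-(δ / n) * (supNorm y : ℝ))
        + 8 * (n : ℝ) ^ 2 * ∑ y ∈ S', Real.exp (-(δ / n) * (supNorm y : ℝ)) / ((supNorm y : ℝ) + 1) ^ 2 := by
        rw [hg, Finset.sum_add_distrib, Finset.mul_sum, Finset.mul_sum]
    _ ≤ 2 * ((1 + 480 * Real.exp (δ / 2) * (2 / δ) ^ 4) * (n : ℝ) ^ 4)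
        + 8 * (n : ℝ) ^ 2 * ((1 + 80 * Real.exp (δ / 2) * (2 / δ) ^ 2) * (n : ℝ) ^ 2) := by gcongr
    _ = _ := by ring

/-! ## §2 (MIX-1) `tr(G_C·Q̇Γ₀Q̇ᵀ)` — two averaging 3-jets joined by the constrained covariance and by the coarse covariance

The loop kernel in the two insertions `(b, b′)` is the finite sum
`k₁(b,b′) = Σ_{u∈U b} Σ_{u′∈U b′} G(u′,u)·Σ_{w∈W} Σ_{w′∈W} q̇(u;b,b+w)·Γ₀(b+w,b′+w′)·q̇(u′;b′,b′+w′)`. -/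

section Mix1

variable {U : Pt → Finset Pt} {W : Finset Pt} {qd : Pt → Pt → Pt → ℝ} {G Γ : Pt → Pt → ℝ} {A C_G C_Γ N₀ δ : ℝ} {n : ℕ}

/-- [folklore] Exchange of a four-fold finite sum: `Σ_u Σ_{u′} Σ_w Σ_{w′} = Σ_w Σ_{w′} Σ_u Σ_{u′}`. -/
theorem sum_comm₄ (s s' t t' : Finset Pt) (F : Pt → Pt → Pt → Pt → ℝ) :
    ∑ u ∈ s, ∑ u' ∈ s', ∑ w ∈ t, ∑ w' ∈ t', F u u' w w' = ∑ w ∈ t, ∑ w' ∈ t', ∑ u ∈ s, ∑ u' ∈ s', F u u' w w' := by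
  calc ∑ u ∈ s, ∑ u' ∈ s', ∑ w ∈ t, ∑ w' ∈ t', F u u' w w' = ∑ u ∈ s, ∑ w ∈ t, ∑ w' ∈ t', ∑ u' ∈ s', F u u' w w' :=
        Finset.sum_congr rfl fun u _ => by
          rw [Finset.sum_comm]
          exact Finset.sum_congr rfl fun w _ => Finset.sum_comm
    _ = ∑ w ∈ t, ∑ u ∈ s, ∑ w' ∈ t', ∑ u' ∈ s', F u u' w w' := Finset.sum_comm
    _ = _ := Finset.sum_congr rfl fun w _ => Finset.sum_comm

/-- **(MIX-1) BY THE VERTEX SUM** (no pointwise shape is claimed): with the pointwise-in-the-field-leg mass `Σ_{u∈U b}|q̇(u;b,b+w)| ≤ A∕n⁴` and the sup letter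
`|G_C| ≤ C_G·n²`, `|k₁(b,b′)| ≤ C_G·n²·(A∕n⁴)²·Σ_{w,w′∈W}|Γ₀(b+w,b′+w′)|`. [folklore] -/
theorem abs_mix1_le_vertexSum (hqpt : ∀ b w, ∑ u ∈ U b, |qd u b (b + w)| ≤ A / (n : ℝ) ^ 4)
    (hG : ∀ u u', |G u u'| ≤ C_G * (n : ℝ) ^ 2) (b b' : Pt) :
    |∑ u ∈ U b, ∑ u' ∈ U b', G u' u *
        ∑ w ∈ W, ∑ w' ∈ W, qd u b (b + w) * Γ (b + w) (b' + w') * qd u' b' (b' + w')|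
      ≤ C_G * (n : ℝ) ^ 2 * (A / (n : ℝ) ^ 4) ^ 2 * ∑ w ∈ W, ∑ w' ∈ W, |Γ (b + w) (b' + w')| := by
  have hCG : 0 ≤ C_G * (n : ℝ) ^ 2 := (abs_nonneg _).trans (hG b b)
  have hA : 0 ≤ A / (n : ℝ) ^ 4 := (Finset.sum_nonneg fun u _ => abs_nonneg _).trans (hqpt b 0)
  set c : ℝ := C_G * (n : ℝ) ^ 2 with hc
  -- step 1: absolute values inside, `|G| ≤ C_G n²`, the constant pushed in
  have h1 : |∑ u ∈ U b, ∑ u' ∈ U b', G u' u *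
        ∑ w ∈ W, ∑ w' ∈ W, qd u b (b + w) * Γ (b + w) (b' + w') * qd u' b' (b' + w')|
      ≤ ∑ u ∈ U b, ∑ u' ∈ U b', ∑ w ∈ W, ∑ w' ∈ W,
          c * (|qd u b (b + w)| * |Γ (b + w) (b' + w')| * |qd u' b' (b' + w')|) := by
    refine (Finset.abs_sum_le_sum_abs _ _).trans (Finset.sum_le_sum fun u _ =>
      (Finset.abs_sum_le_sum_abs _ _).trans (Finset.sum_le_sum fun u' _ => ?_))
    rw [abs_mul]
    refine (mul_le_mul (hG u' u) ((Finset.abs_sum_le_sum_abs _ _).trans (Finset.sum_le_sum fun w _ =>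
      Finset.abs_sum_le_sum_abs _ _)) (abs_nonneg _) hCG).trans (le_of_eq ?_)
    rw [Finset.mul_sum]
    refine Finset.sum_congr rfl fun w _ => ?_
    rw [Finset.mul_sum]
    exact Finset.sum_congr rfl fun w' _ => by rw [abs_mul, abs_mul]
  -- step 2: vertices first, the two `u`-masses factor
  have h2 : ∑ u ∈ U b, ∑ u' ∈ U b', ∑ w ∈ W, ∑ w' ∈ W,
          c * (|qd u b (b + w)| * |Γ (b + w) (b' + w')| * |qd u' b' (b' + w')|)
      = c * ∑ w ∈ W, ∑ w' ∈ W, |Γ (b + w) (b' + w')| *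
          ((∑ u ∈ U b, |qd u b (b + w)|) * (∑ u' ∈ U b', |qd u' b' (b' + w')|)) := by
    rw [sum_comm₄, Finset.mul_sum]
    refine Finset.sum_congr rfl fun w _ => ?_
    rw [Finset.mul_sum]
    refine Finset.sum_congr rfl fun w' _ => ?_
    rw [Finset.sum_mul_sum, Finset.mul_sum, Finset.mul_sum]
    refine Finset.sum_congr rfl fun u _ => ?_
    rw [Finset.mul_sum, Finset.mul_sum]
    exact Finset.sum_congr rfl fun u' _ => by ring
  -- step 3: the masses
  have h3 : ∀ w ∈ W, ∀ w' ∈ W, |Γ (b + w) (b' + w')| * ((∑ u ∈ U b, |qd u b (b + w)|) * (∑ u' ∈ U b', |qd u' b' (b' + w')|))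
      ≤ |Γ (b + w) (b' + w')| * ((A / (n : ℝ) ^ 4) * (A / (n : ℝ) ^ 4)) := fun w _ w' _ =>
    mul_le_mul_of_nonneg_left (mul_le_mul (hqpt b w) (hqpt b' w') (Finset.sum_nonneg fun u _ => abs_nonneg _) hA)
      (abs_nonneg _)
  calc _ ≤ _ := h1
    _ = _ := h2
    _ ≤ c * ∑ w ∈ W, ∑ w' ∈ W, |Γ (b + w) (b' + w')| * ((A / (n : ℝ) ^ 4) * (A / (n : ℝ) ^ 4)) :=
        mul_le_mul_of_nonneg_left (Finset.sum_le_sum fun w hw => Finset.sum_le_sum fun w' hw' => h3 w hw w' hw') hCG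
    _ = C_G * (n : ℝ) ^ 2 * (A / (n : ℝ) ^ 4) ^ 2 * ∑ w ∈ W, ∑ w' ∈ W, |Γ (b + w) (b' + w')| := by
        rw [hc, Finset.mul_sum, Finset.mul_sum]
        refine Finset.sum_congr rfl fun w _ => ?_
        rw [Finset.mul_sum, Finset.mul_sum]
        exact Finset.sum_congr rfl fun w' _ => by ring

/-- **(MIX-1) SECOND MOMENT, n-FREE**: with the letters (q̇-pt) `Σ_{u∈U b}|q̇(u;b,b+w)| ≤ A∕n⁴`, field-leg offsets `‖w‖∞ ≤ n`, `#W ≤ N₀·n`, (G_C) `|G| ≤ C_G·n²`,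
(Γ₀) `|Γ₀(c,c′)| ≤ C_Γ(‖c−c′‖∞+1)⁻²e^{−(δ∕n)‖c−c′‖∞}`: for every finite set `S` of second insertions,
`Σ_{b′∈S} ‖b′−b‖∞²·|k₁(b,b′)| ≤ C_G·A²·N₀²·C_Γ·(2(1 + 480e^{δ∕2}(2∕δ)⁴) + 8(1 + 80e^{δ∕2}(2∕δ)²))` — powers `n²·n⁻⁸·(N₀n)²·n⁴ = n⁰`, EXACT. [folklore] -/
theorem mix1_secondMoment_le (hδ : 0 < δ) (hn : 1 ≤ n) (hW : ∀ w ∈ W, supNorm w ≤ n) (hWcard : (W.card : ℝ) ≤ N₀ * n)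
    (hqpt : ∀ b w, ∑ u ∈ U b, |qd u b (b + w)| ≤ A / (n : ℝ) ^ 4) (hG : ∀ u u', |G u u'| ≤ C_G * (n : ℝ) ^ 2)
    (hΓ : ∀ c c', |Γ c c'| ≤ C_Γ / ((supNorm (c - c') : ℝ) + 1) ^ 2 * Real.exp (-(δ / n) * (supNorm (c - c') : ℝ)))
    (b : Pt) (S : Finset Pt) :
    ∑ b' ∈ S, (supNorm (b' - b) : ℝ) ^ 2 *
        |∑ u ∈ U b, ∑ u' ∈ U b', G u' u *
          ∑ w ∈ W, ∑ w' ∈ W, qd u b (b + w) * Γ (b + w) (b' + w') * qd u' b' (b' + w')|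
      ≤ C_G * A ^ 2 * N₀ ^ 2 * C_Γ *
          (2 * (1 + 480 * Real.exp (δ / 2) * (2 / δ) ^ 4) + 8 * (1 + 80 * Real.exp (δ / 2) * (2 / δ) ^ 2)) := by
  have hn' : (0 : ℝ) < n := by exact_mod_cast hn
  have hCG : 0 ≤ C_G * (n : ℝ) ^ 2 := (abs_nonneg _).trans (hG b b)
  have hCΓ : 0 ≤ C_Γ := by
    have h := hΓ b b
    rw [sub_self, show supNorm (0 : Pt) = 0 from
      Literature.MathematicalPhysics.QuantumFieldTheory.Balaban1983to89.Beta.DyadicShell.supNorm_eq_zero_iff.mpr rfl] at h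
    norm_num at h
    exact (abs_nonneg _).trans h
  set K : ℝ := 2 * (1 + 480 * Real.exp (δ / 2) * (2 / δ) ^ 4) + 8 * (1 + 80 * Real.exp (δ / 2) * (2 / δ) ^ 2) with hK
  set P : ℝ := C_G * (n : ℝ) ^ 2 * (A / (n : ℝ) ^ 4) ^ 2 with hP
  have hP0 : 0 ≤ P := by positivity
  -- step 1: vertex sum, termwise
  have h1 : ∀ b' ∈ S, (supNorm (b' - b) : ℝ) ^ 2 *
      |∑ u ∈ U b, ∑ u' ∈ U b', G u' u * ∑ w ∈ W, ∑ w' ∈ W, qd u b (b + w) * Γ (b + w) (b' + w') * qd u' b' (b' + w')|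
        ≤ P * ∑ w ∈ W, ∑ w' ∈ W, (supNorm (b' - b) : ℝ) ^ 2 *
            (C_Γ * (Real.exp (-(δ / n) * (supNorm (b + w - (b' + w')) : ℝ)) / ((supNorm (b + w - (b' + w')) : ℝ) + 1) ^ 2)) := by
    intro b' _
    have h := abs_mix1_le_vertexSum (W := W) (Γ := Γ) hqpt hG b b'
    have h0 : 0 ≤ (supNorm (b' - b) : ℝ) ^ 2 := by positivity
    calc _ ≤ (supNorm (b' - b) : ℝ) ^ 2 * (P * ∑ w ∈ W, ∑ w' ∈ W, |Γ (b + w) (b' + w')|) := mul_le_mul_of_nonneg_left h h0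
      _ = P * ∑ w ∈ W, ∑ w' ∈ W, (supNorm (b' - b) : ℝ) ^ 2 * |Γ (b + w) (b' + w')| := by
          simp only [Finset.mul_sum]
          exact Finset.sum_congr rfl fun w _ => Finset.sum_congr rfl fun w' _ => by ring
      _ ≤ _ := by
          gcongr with w hw w' hw'
          refine (hΓ _ _).trans (le_of_eq ?_)
          ring
  -- step 2: swap `Σ_{b′}` inside and apply the smeared-profile second moment for each pair of offsets
  have h2 : ∀ w ∈ W, ∀ w' ∈ W, ∑ b' ∈ S, (supNorm (b' - b) : ℝ) ^ 2 *
      (C_Γ * (Real.exp (-(δ / n) * (supNorm (b + w - (b' + w')) : ℝ)) / ((supNorm (b + w - (b' + w')) : ℝ) + 1) ^ 2))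
        ≤ C_Γ * (K * (n : ℝ) ^ 4) := by
    intro w hw w' hw'
    have hc : supNorm (b + w - b) ≤ n := by rw [add_sub_cancel_left]; exact hW w hw
    have h := sum_sq_shift_profile_le hδ hn (c := b + w) hc (hW w' hw') S
    calc _ = C_Γ * ∑ b' ∈ S, (supNorm (b' - b) : ℝ) ^ 2 *
          (Real.exp (-(δ / n) * (supNorm (b + w - (b' + w')) : ℝ)) / ((supNorm (b + w - (b' + w')) : ℝ) + 1) ^ 2) := by
            rw [Finset.mul_sum]; exact Finset.sum_congr rfl fun b' _ => by ring
      _ ≤ C_Γ * (K * (n : ℝ) ^ 4) := mul_le_mul_of_nonneg_left h hCΓ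
  calc _ ≤ ∑ b' ∈ S, P * ∑ w ∈ W, ∑ w' ∈ W, (supNorm (b' - b) : ℝ) ^ 2 *
          (C_Γ * (Real.exp (-(δ / n) * (supNorm (b + w - (b' + w')) : ℝ)) / ((supNorm (b + w - (b' + w')) : ℝ) + 1) ^ 2)) :=
        Finset.sum_le_sum h1
    _ = P * ∑ w ∈ W, ∑ w' ∈ W, ∑ b' ∈ S, (supNorm (b' - b) : ℝ) ^ 2 *
          (C_Γ * (Real.exp (-(δ / n) * (supNorm (b + w - (b' + w')) : ℝ)) / ((supNorm (b + w - (b' + w')) : ℝ) + 1) ^ 2)) := by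
        rw [← Finset.mul_sum, Finset.sum_comm]
        congr 1
        exact Finset.sum_congr rfl fun w _ => Finset.sum_comm
    _ ≤ P * ∑ w ∈ W, ∑ w' ∈ W, C_Γ * (K * (n : ℝ) ^ 4) := by
        gcongr with w hw w' hw'
        exact h2 w hw w' hw'
    _ = P * ((W.card : ℝ) ^ 2 * (C_Γ * (K * (n : ℝ) ^ 4))) := by
        rw [Finset.sum_const, Finset.sum_const, nsmul_eq_mul, nsmul_eq_mul]; ring
    _ ≤ P * ((N₀ * n) ^ 2 * (C_Γ * (K * (n : ℝ) ^ 4))) := by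
        have hK0 : 0 ≤ K := by positivity
        gcongr
    _ = C_G * A ^ 2 * N₀ ^ 2 * C_Γ * K := by
        rw [hP]; field_simp

/-! ## §3 `tsum` forms over all second insertions (MIX-1 here, MIX-2 of FILE A) — what RHOA-6e ∕ RHOA-8's `HasSum` bookkeeping consumes -/

/-- **(MIX-1) SUMMABLE SECOND MOMENT OVER `ℤ⁴`**: the family `b′ ↦ ‖b′−b‖²·|k₁(b,b′)|` is summable and its sum obeys the n-free bound of `mix1_secondMoment_le`. [folklore] -/
theorem tsum_mix1_secondMoment_le (hδ : 0 < δ) (hn : 1 ≤ n) (hW : ∀ w ∈ W, supNorm w ≤ n) (hWcard : (W.card : ℝ) ≤ N₀ * n)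
    (hqpt : ∀ b w, ∑ u ∈ U b, |qd u b (b + w)| ≤ A / (n : ℝ) ^ 4) (hG : ∀ u u', |G u u'| ≤ C_G * (n : ℝ) ^ 2)
    (hΓ : ∀ c c', |Γ c c'| ≤ C_Γ / ((supNorm (c - c') : ℝ) + 1) ^ 2 * Real.exp (-(δ / n) * (supNorm (c - c') : ℝ)))
    (b : Pt) :
    (Summable fun b' : Pt => (supNorm (b' - b) : ℝ) ^ 2 *
        |∑ u ∈ U b, ∑ u' ∈ U b', G u' u *
          ∑ w ∈ W, ∑ w' ∈ W, qd u b (b + w) * Γ (b + w) (b' + w') * qd u' b' (b' + w')|) ∧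
    ∑' b' : Pt, (supNorm (b' - b) : ℝ) ^ 2 *
        |∑ u ∈ U b, ∑ u' ∈ U b', G u' u *
          ∑ w ∈ W, ∑ w' ∈ W, qd u b (b + w) * Γ (b + w) (b' + w') * qd u' b' (b' + w')|
      ≤ C_G * A ^ 2 * N₀ ^ 2 * C_Γ *
          (2 * (1 + 480 * Real.exp (δ / 2) * (2 / δ) ^ 4) + 8 * (1 + 80 * Real.exp (δ / 2) * (2 / δ) ^ 2)) := by
  have h := mix1_secondMoment_le (U := U) (qd := qd) (G := G) (Γ := Γ) hδ hn hW hWcard hqpt hG hΓ b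
  have h0 : 0 ≤ fun b' : Pt => (supNorm (b' - b) : ℝ) ^ 2 *
      |∑ u ∈ U b, ∑ u' ∈ U b', G u' u * ∑ w ∈ W, ∑ w' ∈ W, qd u b (b + w) * Γ (b + w) (b' + w') * qd u' b' (b' + w')| :=
    fun b' => by positivity
  exact ⟨summable_of_sum_le h0 h, Real.tsum_le_of_sum_le h0 h⟩

/-- **(MIX-2) SUMMABLE SECOND MOMENT OVER `ℤ⁴`** (the `tsum` form of FILE A's `MixLoopPowerCounting.mix2_secondMoment_le`). [folklore] -/
theorem tsum_mix2_secondMoment_le {I : Pt → Pt → ℝ} {C_I : ℝ} (hδ : 0 < δ) (hn : 1 ≤ n) (hU : ∀ b, ∀ u ∈ U b, supNorm (b - (n : ℤ) • u) ≤ n)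
    (hW : ∀ w ∈ W, supNorm w ≤ n) (hq : ∀ b, ∑ u ∈ U b, ∑ w ∈ W, |qd u b (b + w)| ≤ A / (n : ℝ) ^ 3)
    (hI : ∀ c u, |I c u| ≤ C_I * Real.exp (-(δ / n) * (supNorm (c - (n : ℤ) • u) : ℝ))) (b : Pt) :
    (Summable fun b' : Pt => (supNorm (b' - b) : ℝ) ^ 2 *
        |∑ u ∈ U b, ∑ u' ∈ U b', (∑ w ∈ W, qd u b (b + w) * I (b + w) u') * (∑ w' ∈ W, qd u' b' (b' + w') * I (b' + w') u)|) ∧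
    ∑' b' : Pt, (supNorm (b' - b) : ℝ) ^ 2 *
        |∑ u ∈ U b, ∑ u' ∈ U b', (∑ w ∈ W, qd u b (b + w) * I (b + w) u') * (∑ w' ∈ W, qd u' b' (b' + w') * I (b' + w') u)|
      ≤ A ^ 2 * (C_I * Real.exp (2 * δ)) ^ 2 * (1 + 9600 * Real.exp δ * δ⁻¹ ^ 6) := by
  have h := mix2_secondMoment_le (U := U) (qd := qd) (I := I) hδ hn hU hW hq hI b
  have h0 : 0 ≤ fun b' : Pt => (supNorm (b' - b) : ℝ) ^ 2 *
      |∑ u ∈ U b, ∑ u' ∈ U b', (∑ w ∈ W, qd u b (b + w) * I (b + w) u') * (∑ w' ∈ W, qd u' b' (b' + w') * I (b' + w') u)| :=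
    fun b' => by positivity
  exact ⟨summable_of_sum_le h0 h, Real.tsum_le_of_sum_le h0 h⟩

end Mix1

end Summit.QuantumFields.BalabanUV.Beta.FP.MixLoopPowerCountingGamma

end
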